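/-
Copyright (c) 2026. All rights reserved.
Released under Apache 2.0 license as described in the file LICENSE.
Authors: HodgeCM publication cell (pub-hodgecm), GR lane, seat GR-2 (`pub-hodgecm-own-hyp34`).
-/
import Literature.RepresentationTheory.HeisenbergGroup.SymplecticSiegelGenerationBigCell
import Mathlib.Topology.Algebra.RestrictedProduct.Basic
import Mathlib.Topology.Algebra.RestrictedProduct.Units
import HarnessLib

/-!
# The big-cell shift property passes to restricted products

Topic `RepresentationTheory/HeisenbergGroup`; namespace `Literature.RepresentationTheory.HeisenbergGroup.SymplecticMatrix`.
KERNEL ONLY: theorems, no definition, nothing asserted.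

`SymplecticSiegelGenerationBigCell` generates `Sp_{2l}(R) = ⟨m(GL_l(R)), n(Sym_l(R)), J⟩` from the big-cell shift property
of `R` (every symplectic `fromBlocks A B C D` admits a symmetric `X` with `A + X C` invertible) and proves it for local
rings and for products.  Here: **restricted products** `Πʳ i, [K i, O i]_[𝓕]` (Mathlib `RestrictedProduct`: the families
`(x_i) ∈ ∏ K_i` with `x_i ∈ O_i` for `𝓕`-almost all `i`, `O_i ⊆ K_i` subrings).  If every `K_i` and every `O_i` has the
property then so does the restricted product (`bigCellReachable_restrictedProduct`): the shift is chosen componentwise,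
INSIDE `O_i` at every index where the given symplectic matrix is `O_i`-integral (almost all indices) and in `K_i`
elsewhere; the resulting `X` is again a restricted-product matrix, and `det (A + X C)` is a unit by Mathlib's
`RestrictedProduct.isUnit_iff` (a unit at every index and an `O_i`-unit at almost every index).  The case of record is
the finite adele ring `𝐀_F^∞ = Πʳ_v [F_v, 𝒪_v]` of a number field (`F_v` a field and `𝒪_v` a discrete valuation ring,
both local), whence `Sp_{2n}(𝐀_F)` is generated by the Siegel parabolic and `J` (sequel) — the group-theoretic input of
[Weil1964, Chap. III n° 37] (adelic metaplectic operators exist for every adelic symplectic automorphism because they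
exist for the generators).

## References
* [Weil1964] A. Weil, Acta Math. 111 (1964) 143–211, Chap. III n° 37 (restricted products `Sp(X_A)`).
* [MoeglinVignerasWaldspurger1987] C. Mœglin, M.-F. Vignéras, J.-L. Waldspurger, LNM 1291 (1987), Chap. 2 II.5.
-/

open Matrix Filter

namespace Literature.RepresentationTheory.HeisenbergGroup.SymplecticMatrix

variable {l : Type*} [DecidableEq l] [Fintype l]

/-- symplecticity descends along an INJECTIVE ring homomorphism applied entrywise (the symplectic relation
`g J gᵀ = J` is an identity of matrix entries). [cite: MoeglinVignerasWaldspurger1987, Chap. 2 II.1] -/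
theorem mem_symplecticGroup_of_map_injective {R S : Type*} [CommRing R] [CommRing S] (f : R →+* S)
    (hf : Function.Injective f) {g : Matrix (l ⊕ l) (l ⊕ l) R} (h : g.map f ∈ Matrix.symplecticGroup l S) :
    g ∈ Matrix.symplecticGroup l R := by
  rw [SymplecticGroup.mem_iff] at h ⊢
  apply Matrix.map_injective hf
  change (g * J l R * gᵀ).map f = (J l R).map f
  rw [Matrix.map_mul, Matrix.map_mul, Matrix.transpose_map, Matrix.map_J]
  exact h

/-- **Restricted products inherit the big-cell shift property.**  Let `K_i` be commutative rings with subrings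
`O_i` (`SubringClass`), `𝓕` a filter on the index set; if every `K_i` and every `O_i` has the big-cell shift property,
so does `Πʳ i, [K i, O i]_[𝓕]`: for a symplectic `fromBlocks A B C D` over the restricted product choose, at each index,
a symmetric shift `X_i` — inside `O_i` with `det(A_i + X_i C_i) ∈ O_iˣ` wherever the matrix is `O_i`-integral (an
`𝓕`-large set of indices), in `K_i` elsewhere; then `X = (X_i)` is a symmetric restricted-product matrix and
`det(A + X C) = (det(A_i + X_i C_i))_i` is a unit (`RestrictedProduct.isUnit_iff`).
[cite: Weil1964, Chap. III n° 37; MoeglinVignerasWaldspurger1987, Chap. 2 II.5] -/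
theorem bigCellReachable_restrictedProduct {ι : Type*} {K : ι → Type*} [∀ i, CommRing (K i)]
    {S : ι → Type*} [∀ i, SetLike (S i) (K i)] [∀ i, SubringClass (S i) (K i)] {O : ∀ i, S i} {𝓕 : Filter ι}
    (hK : ∀ i, ∀ ⦃A B C D : Matrix l l (K i)⦄, fromBlocks A B C D ∈ Matrix.symplecticGroup l (K i) →
        ∃ X : Matrix l l (K i), X.IsSymm ∧ IsUnit (A + X * C).det)
    (hO : ∀ i, ∀ ⦃A B C D : Matrix l l (O i)⦄, fromBlocks A B C D ∈ Matrix.symplecticGroup l (O i) →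
        ∃ X : Matrix l l (O i), X.IsSymm ∧ IsUnit (A + X * C).det) :
    ∀ ⦃A B C D : Matrix l l (RestrictedProduct (fun i => K i) (fun i => (O i : Set (K i))) 𝓕)⦄,
      fromBlocks A B C D ∈
          Matrix.symplecticGroup l (RestrictedProduct (fun i => K i) (fun i => (O i : Set (K i))) 𝓕) →
        ∃ X : Matrix l l (RestrictedProduct (fun i => K i) (fun i => (O i : Set (K i))) 𝓕),
          X.IsSymm ∧ IsUnit (A + X * C).det := by
  intro A B C D hg
  classical
  -- the components
  let ev : ∀ i, RestrictedProduct (fun i => K i) (fun i => (O i : Set (K i))) 𝓕 →+* K i := fun i =>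
    RestrictedProduct.evalRingHom K i
  have hev : ∀ (i : ι) (x : RestrictedProduct (fun i => K i) (fun i => (O i : Set (K i))) 𝓕), ev i x = x i :=
    fun i x => rfl
  -- at each index: a symmetric shift, integral with integral-unit determinant where the matrix is integral
  have hloc : ∀ i, ∃ X : Matrix l l (K i), X.IsSymm ∧ IsUnit (A.map (ev i) + X * C.map (ev i)).det ∧
      ((∀ a b, fromBlocks A B C D a b i ∈ O i) →
        (∀ a b, X a b ∈ O i) ∧ ∃ h : (A.map (ev i) + X * C.map (ev i)).det ∈ O i,
          IsUnit (⟨(A.map (ev i) + X * C.map (ev i)).det, h⟩ : O i)) := by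
    intro i
    by_cases hi : ∀ a b, fromBlocks A B C D a b i ∈ O i
    · -- the matrix is `O_i`-integral: shift inside `O_i`
      let AO : Matrix l l (O i) := Matrix.of fun a b => ⟨A a b i, hi (Sum.inl a) (Sum.inl b)⟩
      let BO : Matrix l l (O i) := Matrix.of fun a b => ⟨B a b i, hi (Sum.inl a) (Sum.inr b)⟩
      let CO : Matrix l l (O i) := Matrix.of fun a b => ⟨C a b i, hi (Sum.inr a) (Sum.inl b)⟩
      let DO : Matrix l l (O i) := Matrix.of fun a b => ⟨D a b i, hi (Sum.inr a) (Sum.inr b)⟩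
      have hA : AO.map (SubringClass.subtype (O i)) = A.map (ev i) := by ext a b; rfl
      have hB : BO.map (SubringClass.subtype (O i)) = B.map (ev i) := by ext a b; rfl
      have hC : CO.map (SubringClass.subtype (O i)) = C.map (ev i) := by ext a b; rfl
      have hD : DO.map (SubringClass.subtype (O i)) = D.map (ev i) := by ext a b; rfl
      have hmemO : fromBlocks AO BO CO DO ∈ Matrix.symplecticGroup l (O i) := by
        refine mem_symplecticGroup_of_map_injective (SubringClass.subtype (O i)) Subtype.val_injective ?_
        rw [Matrix.fromBlocks_map, hA, hB, hC, hD]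
        exact fromBlocks_map_mem_symplecticGroup (ev i) hg
      obtain ⟨XO, hXO, huO⟩ := hO i hmemO
      have hdet : SubringClass.subtype (O i) (AO + XO * CO).det =
          (A.map (ev i) + XO.map (SubringClass.subtype (O i)) * C.map (ev i)).det := by
        rw [map_det_add_mul, hA, hC]
      refine ⟨XO.map (SubringClass.subtype (O i)), hXO.map _, ?_, fun _ => ⟨fun a b => (XO a b).2, ?_⟩⟩
      · rw [← hdet]
        exact huO.map _
      · refine ⟨by rw [← hdet]; exact ((AO + XO * CO).det).2, ?_⟩
        have h2 : (⟨(A.map (ev i) + XO.map (SubringClass.subtype (O i)) * C.map (ev i)).det,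
            by rw [← hdet]; exact ((AO + XO * CO).det).2⟩ : O i) = (AO + XO * CO).det :=
          Subtype.ext hdet.symm
        rw [h2]
        exact huO
    · -- elsewhere: shift in `K_i`
      obtain ⟨X, hX, hu⟩ := hK i (fromBlocks_map_mem_symplecticGroup (ev i) hg)
      exact ⟨X, hX, hu, fun h => absurd h hi⟩
  choose X hXs hXu hXO using hloc
  -- almost every index is integral
  have hev_int : ∀ᶠ i in 𝓕, ∀ a b, fromBlocks A B C D a b i ∈ O i := by
    refine Filter.eventually_all.2 fun a => Filter.eventually_all.2 fun b => ?_
    exact (fromBlocks A B C D a b).2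
  -- the assembled shift
  let Xr : Matrix l l (RestrictedProduct (fun i => K i) (fun i => (O i : Set (K i))) 𝓕) :=
    Matrix.of fun a b => RestrictedProduct.mk (fun i => X i a b)
      (hev_int.mono fun i hi => (hXO i hi).1 a b)
  have hXr : ∀ i, Xr.map (ev i) = X i := fun i => by ext a b; rfl
  have hdet : ∀ i, (A + Xr * C).det i = (A.map (ev i) + X i * C.map (ev i)).det := fun i => by
    rw [← hev, map_det_add_mul, hXr]
  refine ⟨Xr, ?_, ?_⟩
  · -- symmetric: componentwise
    ext a b i
    change X i b a = X i a b
    exact (hXs i).apply a b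
  · -- unit determinant: a unit everywhere, an `O_i`-unit almost everywhere
    refine RestrictedProduct.isUnit_iff.2 ⟨fun i => ?_, ?_⟩
    · rw [hdet]
      exact hXu i
    · refine hev_int.mono fun i hi => ?_
      have h := (hXO i hi).2
      rw [← hdet] at h
      exact h

/-- **`Sp_{2l}` of a restricted product of LOCAL rings with respect to local subrings is generated by the Siegel
parabolic and the Weyl element** — e.g. the finite adele ring `Πʳ_v [F_v, 𝒪_v]` of a number field (`F_v` a field,
`𝒪_v` a valuation ring). [cite: Weil1964, Chap. III n° 37; MoeglinVignerasWaldspurger1987, Chap. 2 II.5] -/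
theorem closure_generators_eq_top_restrictedProduct {ι : Type*} {K : ι → Type*} [∀ i, CommRing (K i)]
    {S : ι → Type*} [∀ i, SetLike (S i) (K i)] [∀ i, SubringClass (S i) (K i)] {O : ∀ i, S i} {𝓕 : Filter ι}
    [∀ i, IsLocalRing (K i)] [∀ i, IsLocalRing (O i)] :
    Subgroup.closure (generators l (RestrictedProduct (fun i => K i) (fun i => (O i : Set (K i))) 𝓕)) = ⊤ :=
  closure_generators_eq_top_of_bigCellReachable
    (bigCellReachable_restrictedProduct (fun i => bigCellReachable_of_isLocalRing (R := K i))
      (fun i => bigCellReachable_of_isLocalRing (R := O i)))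

end Literature.RepresentationTheory.HeisenbergGroup.SymplecticMatrix
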